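import Summits.BirchSwinnertonDyer.BirchSwinnertonDyer.Theorems.GenusKolyvaginAtTwoMinimalTwinBSDTwoConverseSupplies
import Summits.BirchSwinnertonDyer.BirchSwinnertonDyer.Theorems.GenusKolyvaginAtTwoMinimalTwinBSDTwoDoorOpenPrimes
import Summits.BirchSwinnertonDyer.BirchSwinnertonDyer.Theorems.GenusKolyvaginAtTwoMinimalTwinBSDTwoSwappedPairSilentPrime
import HarnessLib

/-!
# Route `GenusKolyvaginAtTwo`, crux U₂ `MinimalTwinBSDTwo` (stmt-BirchSwinnertonDyer-22985), LINE 23 «twin_swap»: THE TWO CELL ENGINES AT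
# EVERY TAMAGAWA DEPTH — on `Δ < 0` U₂ needs NOTHING but the rank-zero wall, the rank-zero 2-converse and the 2-adic exponent of `y_K`
# (no Tamagawa cell, no image hypothesis); on the egg the same with `ρ̄_{W,2}` onto

Seat `bsd-line-gk2-p2` g25 (PROVER seat 2/3, cell `bsd-f1-sign2`; LINE 23 holder), `--supports stmt-BirchSwinnertonDyer-22985` (helper; closes
nothing).  THEOREMS ONLY (no definition, no named fact, no `sorry`); standard axioms.  **BSD is NOT proved by this file; U₂, the wall, the
2-converse, EXP are NOT proved; no item is closed.**  Every theorem is CONDITIONAL on its displayed hypotheses.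

THE POINT (planner currency).  The ledgers of LINE 23 (gk2-p3 p773745 / p775371, this seat's v1.6–v1.7 skeleton) serve U₂ on the two Tamagawa cells
`closes` consumes — hTw1 = (Δ<0, ord₂ C = 1) and hTw0 = (Δ>0, ord₂ C = 0) — and declare the other depths a residual.  But the engines are depth-free:
this seat's g28/g24 lineage `OneBit.swappedPairDescentAtTwo_tamagawaDepth_of_facts` (Δ<0, exponent `ord₂ c + ord₂ C(E)`, twin budget `ord₂ C(Wd) ≤
ord₂ C(E) + 1`) and gk2-p3's `Silent.swappedPairDescentAtTwo_silent_of_facts` (any sign, exponent `ord₂ c + ord₂ C(E)`, all-silent twin), and so are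
the supplies: the door-open prime Heegner twin costs EXACTLY one bit at every depth (`DoorOpen.exists_doorOpen_prime_heegnerField_selmerTrivialTwin`,
p775020, unconditional) and the silent prime twin costs none (`Silent.padicValNat_two_tamagawaProduct_twin_eq_of_discr_eq_neg_prime_of_noRoot`).  Hence:

* §1 **`bsdp_negDisc_of_wall_of_converse_of_exponent_of_facts`** — for EVERY non-CM globally minimal `W` with `r_an = 1`, `#Sel₂ = 2`, **`Δ_W < 0`**
  (ANY `C(W)`, NO image hypothesis — `ρ̄_{W,2}` onto is automatic, p775531 §4): `BSD₂(W)` ⟸ S1 (rank-0 Sel₂-trivial wall) + CONV₀ (rank-0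
  2-converse, all non-CM curves) + **EXP⁻_all** («at every door-open prime Heegner field with `L(W^{(d_K)},1) ≠ 0` and every datum,
  `2^{ord₂ c + ord₂ C(W)} ∥ P(1)`») + PRINT (GZ, GZK, modularity, Milne, BCDT).
* §2 **`bsdp_posDisc_egg_of_wall_of_converse_of_exponent_of_facts`** — for every non-CM globally minimal `W` with `r_an = 1`, `#Sel₂ = 2`,
  `ρ̄_{W,2}` onto, **`Δ_W > 0` and `MeetsEgg W`** (ANY `C(W)`): `BSD₂(W)` ⟸ S1 + CONV₀ + **EXP⁺_all** (silent prime fields, exponent `2^{ord₂ c + ord₂ C(W)}`)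
  + PRINT.
So the whole `Δ < 0` half of U₂ and the whole egg half at `Δ > 0` (mod-2 image onto) are «wall + converse + exponent»; what is left of U₂ is the
`Δ > 0` IDENTITY locus (`¬MeetsEgg`: depth `0` with full 2-adic image = item 32821 `RankOneAtTwoBigImageIdLocus`; positive depth or small 2-adic image
= the two-transposition territory) and `Δ > 0` with `Δ` a square (`ρ̄_{W,2}` not onto).  EXP±_all are the BSD₂ content (lossless at each depth:
`OneBit.twoDivExponent_eq_padicValNat_tamagawa_of_bsdp`, `Silent.twoDivExponent_eq_of_bsdp_silent`).  Nothing here is progress on BSD.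

References: [GrossZagier1986] I.(6.3), V.§2 (2.2); [GrossLMS1991] §1, §4, §5 Prop. 5.3; [McCallumLMS1991] §5 Lemma 5.1; [MazurRubin2010] Prop. 3.3,
Cor. 3.4 (i), Lemma 3.5; [Kramer1981] Thm. 1, §2 Props. 3, 6; [Milne1972ArithmeticAV] §1 Thm. 1; [BCDTJAMS2001] Thm. A; [Miller2011LMS] Def. 1.1.
-/

set_option autoImplicit false
set_option linter.dupNamespace false -- `Summit.<P>.<Sub>` repeats `BirchSwinnertonDyer` (D-0017)

noncomputable section

open scoped Classical

open WeierstrassCurve NumberField Literature.NumberTheory.EllipticCurves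
  Literature.NumberTheory.EllipticCurves.ModularForms
  Literature.NumberTheory.EllipticCurves.Rank1Residual
  Literature.NumberTheory.QuadraticFields
  Summit.BirchSwinnertonDyer.Rank1Residual
  Summit.BirchSwinnertonDyer.Rank1Residual.AdditivePotMult
  Summit.BirchSwinnertonDyer.Rank1Residual.F1Sign2
  Summit.BirchSwinnertonDyer.BirchSwinnertonDyer.Rank1Residual
  Summit.BirchSwinnertonDyer.BirchSwinnertonDyer.Theorems
  Summit.BirchSwinnertonDyer.BirchSwinnertonDyer.Theorems.GenusExact.TwinSwap

open Summit.BirchSwinnertonDyer.BirchSwinnertonDyer.Theorems.GenusExact.TwinSwap.Ledger.Line25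
  (exists_silentPrime_heegnerField_selmerTrivialTwin_of_GZK entireLFunction_twist_one_ne_zero_of_rankZeroTwoConverse_of_natCard_selmerGroup_eq_one
    exists_kolyvaginHeegnerData_one_of_nonempty_modularParametrizationData not_isOfFinAddOrder_derivedPoint_one_of_rankOne_of_lValue_ne_zero)
open Summit.BirchSwinnertonDyer.BirchSwinnertonDyer.Theorems.GenusExact.TwinSwap.OneBit (swappedPairDescentAtTwo_tamagawaDepth_of_facts)
open Summit.BirchSwinnertonDyer.BirchSwinnertonDyer.Theorems.GenusExact.TwinSwap.Silent
  (swappedPairDescentAtTwo_silent_of_facts padicValNat_two_tamagawaProduct_twin_eq_of_discr_eq_neg_prime_of_noRoot)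
open Summit.BirchSwinnertonDyer.BirchSwinnertonDyer.Theorems.GenusExact.TwinSwap.DoorOpen
  (exists_doorOpen_prime_heegnerField_selmerTrivialTwin hasSurjectiveModNGaloisRep_two_of_negDisc_of_natCard_selmerGroup_eq_two)

namespace Summit.BirchSwinnertonDyer.BirchSwinnertonDyer.Theorems.GenusExact.TwinSwap.AllDepth

/-! ## §1 The `Δ < 0` half of U₂ at every depth: wall + converse + EXP⁻_all -/

/-- **U₂ ON `Δ < 0`, EVERY TAMAGAWA DEPTH, FROM THE WALL, THE RANK-ZERO 2-CONVERSE AND THE EXPONENT.**  Hypotheses: the four PRINT facts + the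
modular parametrisation (`hGZ`, `hGZK`, `hmod`, `hMilneC`, `hMP`); `hS1` = LINE 23's anchor S1 (BSD₂ for non-CM rank-0 curves with `#Sel₂ = 1`);
`hC0` = the rank-zero `2`-converse on all non-CM globally minimal curves (= items stmt-19218 + stmt-19219 + the off-semistable residual,
`Ledger.Line25.rankZeroTwoConverse_of_items_of_offSemistable`); `hEXPneg` = EXP⁻_all: for `W` non-CM, `r_an = 1`, `#Sel₂ = 2`, `Δ < 0`, at EVERY
imaginary quadratic `K = ℚ(√−ℓ)` (`ℓ` prime, door open at `ℓ`, `d_K` odd `≠ −3`, Heegner, `2` split) with `L(W^{(d_K)},1) ≠ 0` and EVERY conductor-`1`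
datum: `2^{ord₂ c + ord₂ C(W)} ∣ P(1)` and `2^{ord₂ c + ord₂ C(W) + 1} ∤ P(1)`.  CONCLUSION: `BSD₂(W)` for EVERY non-CM globally minimal `W` with
`r_an = 1`, `#Sel₂ = 2`, `Δ < 0` — no Tamagawa cell, no image hypothesis.  Proof: GZK gives rank `1`, so `ρ̄_{W,2}` is onto (p775531 §4); the door-open
prime Heegner field exists with a globally minimal `2`-Selmer-trivial twin costing exactly one bit (p775020 §2); `#Sel₂(Wd) = 1` + `hC0` give
`L(W^{(d_K)},1) ≠ 0` (p775371), hence `P(1)` of infinite order (p773223 §1) and `r_an(Wd) = 0`, `BSD₂(Wd)` by S1; the exponent by `hEXPneg`; then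
`OneBit.swappedPairDescentAtTwo_tamagawaDepth_of_facts`.  CONDITIONAL on the displayed hypotheses; proves nothing about BSD; closes nothing.
[cite: GrossZagier1986, V.§2 (2.2)] [cite: MazurRubin2010, Prop. 3.3, Cor. 3.4 (i), Lemma 3.5] [cite: McCallumLMS1991, §5 Lemma 5.1]
[cite: Milne1972ArithmeticAV, §1 Thm. 1] [cite: Miller2011LMS, Def. 1.1] -/
theorem bsdp_negDisc_of_wall_of_converse_of_exponent_of_facts
    (hGZ : ∀ (N : ℕ) [NeZero N] (W : WeierstrassCurve ℚ) (K : Type) [Field K] [NumberField K], gross_zagier N W K)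
    (hGZK : rank_eq_analyticRank_of_analyticRank_le_one) (hmod : hasEntireLFunction_rat)
    (hMilneC : Milne1972.bsdQuotient_baseChange_quadratic_anyModel) (hMP : nonempty_modularParametrizationData)
    (hS1 : ∀ (W : WeierstrassCurve ℚ) [W.IsElliptic] [W.IsGloballyMinimal],
      ¬ W.HasCM → W.analyticRank = 0 → Nat.card (W.selmerGroup 2) = 1 → BSDp W 2)
    (hC0 : ∀ (V : WeierstrassCurve ℚ) [V.IsElliptic] [V.IsGloballyMinimal], ¬ V.HasCM → V.selmerCorank 2 = 0 → V.analyticRank = 0)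
    (hEXPneg : ∀ (W : WeierstrassCurve ℚ) [W.IsElliptic] [W.IsGloballyMinimal] [NeZero (W.conductorNorm ℤ)],
      ¬ W.HasCM → W.analyticRank = 1 → Nat.card (W.selmerGroup 2) = 2 → W.Δ < 0 →
      ∀ (K : Type) [Field K] [NumberField K], IsImaginaryQuadratic K →
        ∀ (ℓ : ℕ) [Fact ℓ.Prime], NumberField.discr K = -(ℓ : ℤ) → ¬ W.selmerGroup 2 ≤ MazurRubin2010.strictLocalKer W ℚ_[ℓ] 2 →
        Odd (NumberField.discr K) → NumberField.discr K ≠ -3 → SatisfiesHeegnerHypothesis (W.conductorNorm ℤ) K →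
        ((Ideal.span {(2 : ℤ)}).primesOver (𝓞 K)).ncard = 2 →
        (W.quadraticTwist (NumberField.discr K : ℚ)).entireLFunction 1 ≠ 0 →
        ∀ (Dt : ModularParametrizationData W (W.conductorNorm ℤ)) (β : ℤ) (ι : K →+* ℂ) (d₁ : KolyvaginHeegnerData Dt β ι 1),
          (∃ Q : (W.baseChange (ringClassField K ι 1)).toAffine.Point,
            ((2 ^ (padicValInt 2 Dt.c + padicValNat 2 W.tamagawaProduct) : ℕ) : ℤ) • Q = d₁.derivedPoint) ∧
          (¬ ∃ Q : (W.baseChange (ringClassField K ι 1)).toAffine.Point,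
            ((2 ^ (padicValInt 2 Dt.c + padicValNat 2 W.tamagawaProduct + 1) : ℕ) : ℤ) • Q = d₁.derivedPoint)) :
    ∀ (W : WeierstrassCurve ℚ) [W.IsElliptic] [W.IsGloballyMinimal], ¬ W.HasCM → W.analyticRank = 1 →
      Nat.card (W.selmerGroup 2) = 2 → W.Δ < 0 → BSDp W 2 := by
  intro W _ _ hcm hr hSel hΔ
  haveI : NeZero (W.conductorNorm ℤ) := ⟨(W.conductorNorm_pos_holds).ne'⟩
  -- rank one (GZK), so `ρ̄_{W,2}` is onto on `Δ < 0`
  have hrk : W.mordellWeilRank = 1 := by rw [(hGZK W (le_of_eq hr)).1, hr]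
  have hsurj : W.HasSurjectiveModNGaloisRep 2 :=
    hasSurjectiveModNGaloisRep_two_of_negDisc_of_natCard_selmerGroup_eq_two W hΔ hSel hrk
  -- the door-open prime Heegner field with its globally minimal Sel₂-trivial twin costing exactly one bit (unconditional)
  obtain ⟨ℓ, hℓF, -, -, -, hns, K, _, _, hK, hd, hodd, h3, hH, h2K, -, -, Wd, _, _, ⟨Cd, hCd⟩, hSel1, hTam⟩ :=
    exists_doorOpen_prime_heegnerField_selmerTrivialTwin W hΔ hsurj hSel 0
  haveI := hℓF
  have hD0 : (NumberField.discr K : ℚ) ≠ 0 := by exact_mod_cast NumberField.discr_ne_zero K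
  haveI := W.isElliptic_quadraticTwist hD0
  -- the central value through the rank-zero 2-converse
  have hL : (W.quadraticTwist (NumberField.discr K : ℚ)).entireLFunction 1 ≠ 0 :=
    entireLFunction_twist_one_ne_zero_of_rankZeroTwoConverse_of_natCard_selmerGroup_eq_one hC0 hmod W hcm hD0 Wd hCd hSel1
  -- a conductor-1 datum, its Heegner point of infinite order, and the exponent
  obtain ⟨Dt, β, ι, d₁, hc0⟩ := exists_kolyvaginHeegnerData_one_of_nonempty_modularParametrizationData hMP W K hK hH
  have hy : ¬ IsOfFinAddOrder d₁.derivedPoint :=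
    not_isOfFinAddOrder_derivedPoint_one_of_rankOne_of_lValue_ne_zero hmod W K (hGZ _ W K) hK hH hr hL d₁
  obtain ⟨hdiv, hndiv⟩ := hEXPneg W hcm hr hSel hΔ K hK ℓ hd hns hodd h3 hH h2K hL Dt β ι d₁
  -- the twin is non-CM of analytic rank 0: `BSD₂(Wd)` from the wall
  have hcmd : ¬ Wd.HasCM := by
    rw [← hCd, hasCM_iff_of_j_eq (((W.quadraticTwist (NumberField.discr K : ℚ)).variableChange_j Cd).trans (W.j_quadraticTwist hD0))]
    exact hcm
  have hrd : Wd.analyticRank = 0 := by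
    rw [← hCd, analyticRank_smul]
    exact ((W.quadraticTwist (NumberField.discr K : ℚ)).analyticRank_eq_zero_iff_holds (hmod _)).mpr hL
  have hBd : BSDp Wd 2 := hS1 Wd hcmd hrd hSel1
  exact swappedPairDescentAtTwo_tamagawaDepth_of_facts hGZ hGZK hmod hMilneC W hr hSel hΔ K hK hodd h3 hH Dt hc0 β ι d₁ hy hdiv hndiv
    Wd ⟨Cd, hCd⟩ hSel1 hTam.le hBd

/-! ## §2 The egg half of U₂ at every depth: wall + converse + EXP⁺_all -/

/-- **U₂ ON THE EGG (`Δ > 0`, `MeetsEgg`), EVERY TAMAGAWA DEPTH, FROM THE WALL, THE RANK-ZERO 2-CONVERSE AND THE EXPONENT.**  Same PRINT, S1, CONV₀;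
`hEXPpos` = EXP⁺_all: for `W` non-CM, `r_an = 1`, `#Sel₂ = 2`, `ρ̄_{W,2}` onto, `Δ > 0`, `MeetsEgg W`, at EVERY `K = ℚ(√−ℓ)` (`ℓ` prime, the
`2`-division cubic rootless mod `ℓ`, `d_K` odd `≠ −3`, Heegner) with `L(W^{(d_K)},1) ≠ 0` and EVERY conductor-`1` datum: `2^{ord₂ c + ord₂ C(W)} ∥ P(1)`.
CONCLUSION: `BSD₂(W)` for every non-CM globally minimal `W` with `r_an = 1`, `#Sel₂ = 2`, `ρ̄_{W,2}` onto, `Δ > 0`, `MeetsEgg W` — no Tamagawa cell.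
Proof: the silent prime Heegner field with a globally minimal `2`-Selmer-trivial twin (p775371 §0; the egg decides, p770721) costing NO bit
(`Silent.padicValNat_two_tamagawaProduct_twin_eq_…`); `hC0` gives the `L`-value, hence `P(1)` of infinite order and `BSD₂(Wd)` from S1; the exponent by
`hEXPpos`; then `Silent.swappedPairDescentAtTwo_silent_of_facts`.  CONDITIONAL on the displayed hypotheses; proves nothing about BSD; closes nothing.
[cite: GrossZagier1986, V.§2 (2.2)] [cite: Kramer1981, §2 Props. 3, 6] [cite: MazurRubin2010, Cor. 3.4 (i)] [cite: McCallumLMS1991, §5 Lemma 5.1]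
[cite: Milne1972ArithmeticAV, §1 Thm. 1] [cite: Miller2011LMS, Def. 1.1] -/
theorem bsdp_posDisc_egg_of_wall_of_converse_of_exponent_of_facts
    (hGZ : ∀ (N : ℕ) [NeZero N] (W : WeierstrassCurve ℚ) (K : Type) [Field K] [NumberField K], gross_zagier N W K)
    (hGZK : rank_eq_analyticRank_of_analyticRank_le_one) (hmod : hasEntireLFunction_rat)
    (hMilneC : Milne1972.bsdQuotient_baseChange_quadratic_anyModel) (hMP : nonempty_modularParametrizationData)
    (hS1 : ∀ (W : WeierstrassCurve ℚ) [W.IsElliptic] [W.IsGloballyMinimal],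
      ¬ W.HasCM → W.analyticRank = 0 → Nat.card (W.selmerGroup 2) = 1 → BSDp W 2)
    (hC0 : ∀ (V : WeierstrassCurve ℚ) [V.IsElliptic] [V.IsGloballyMinimal], ¬ V.HasCM → V.selmerCorank 2 = 0 → V.analyticRank = 0)
    (hEXPpos : ∀ (W : WeierstrassCurve ℚ) [W.IsElliptic] [W.IsGloballyMinimal] [NeZero (W.conductorNorm ℤ)],
      ¬ W.HasCM → W.analyticRank = 1 → Nat.card (W.selmerGroup 2) = 2 → W.HasSurjectiveModNGaloisRep 2 → 0 < W.Δ → MeetsEgg W →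
      ∀ (K : Type) [Field K] [NumberField K], IsImaginaryQuadratic K →
        ∀ (ℓ : ℕ), ℓ.Prime → NumberField.discr K = -(ℓ : ℤ) →
        (∀ x : ZMod ℓ, 4 * x ^ 3 + ((integralModelInt W).b₂ : ZMod ℓ) * x ^ 2 +
            2 * ((integralModelInt W).b₄ : ZMod ℓ) * x + ((integralModelInt W).b₆ : ZMod ℓ) ≠ 0) →
        Odd (NumberField.discr K) → NumberField.discr K ≠ -3 → SatisfiesHeegnerHypothesis (W.conductorNorm ℤ) K →
        (W.quadraticTwist (NumberField.discr K : ℚ)).entireLFunction 1 ≠ 0 →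
        ∀ (Dt : ModularParametrizationData W (W.conductorNorm ℤ)) (β : ℤ) (ι : K →+* ℂ) (d₁ : KolyvaginHeegnerData Dt β ι 1),
          (∃ Q : (W.baseChange (ringClassField K ι 1)).toAffine.Point,
            ((2 ^ (padicValInt 2 Dt.c + padicValNat 2 W.tamagawaProduct) : ℕ) : ℤ) • Q = d₁.derivedPoint) ∧
          (¬ ∃ Q : (W.baseChange (ringClassField K ι 1)).toAffine.Point,
            ((2 ^ (padicValInt 2 Dt.c + padicValNat 2 W.tamagawaProduct + 1) : ℕ) : ℤ) • Q = d₁.derivedPoint)) :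
    ∀ (W : WeierstrassCurve ℚ) [W.IsElliptic] [W.IsGloballyMinimal], ¬ W.HasCM → W.analyticRank = 1 →
      Nat.card (W.selmerGroup 2) = 2 → W.HasSurjectiveModNGaloisRep 2 → 0 < W.Δ → MeetsEgg W → BSDp W 2 := by
  intro W _ _ hcm hr hSel hsurj hΔ hegg
  haveI : NeZero (W.conductorNorm ℤ) := ⟨(W.conductorNorm_pos_holds).ne'⟩
  -- the silent prime Heegner field with its globally minimal Sel₂-trivial twin (the egg decides), costing no Tamagawa bit
  obtain ⟨K, _, _, ℓ, hℓ, hK, hd, hsil, hodd, h3, hH, -, Wd, _, _, Cd, hCd, hSel1⟩ :=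
    exists_silentPrime_heegnerField_selmerTrivialTwin_of_GZK hGZK W hΔ hsurj hr hSel hegg
  have hD0 : (NumberField.discr K : ℚ) ≠ 0 := by exact_mod_cast NumberField.discr_ne_zero K
  haveI := W.isElliptic_quadraticTwist hD0
  have hSil : padicValNat 2 Wd.tamagawaProduct = padicValNat 2 W.tamagawaProduct :=
    padicValNat_two_tamagawaProduct_twin_eq_of_discr_eq_neg_prime_of_noRoot W hK hodd hH hℓ hd hsil Cd hCd
  -- the central value through the rank-zero 2-converse
  have hL : (W.quadraticTwist (NumberField.discr K : ℚ)).entireLFunction 1 ≠ 0 :=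
    entireLFunction_twist_one_ne_zero_of_rankZeroTwoConverse_of_natCard_selmerGroup_eq_one hC0 hmod W hcm hD0 Wd hCd hSel1
  -- a conductor-1 datum, its Heegner point of infinite order, and the exponent
  obtain ⟨Dt, β, ι, d₁, hc0⟩ := exists_kolyvaginHeegnerData_one_of_nonempty_modularParametrizationData hMP W K hK hH
  have hy : ¬ IsOfFinAddOrder d₁.derivedPoint :=
    not_isOfFinAddOrder_derivedPoint_one_of_rankOne_of_lValue_ne_zero hmod W K (hGZ _ W K) hK hH hr hL d₁
  obtain ⟨hdiv, hndiv⟩ := hEXPpos W hcm hr hSel hsurj hΔ hegg K hK ℓ hℓ hd hsil hodd h3 hH hL Dt β ι d₁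
  -- the twin is non-CM of analytic rank 0: `BSD₂(Wd)` from the wall
  have hcmd : ¬ Wd.HasCM := by
    rw [← hCd, hasCM_iff_of_j_eq (((W.quadraticTwist (NumberField.discr K : ℚ)).variableChange_j Cd).trans (W.j_quadraticTwist hD0))]
    exact hcm
  have hrd : Wd.analyticRank = 0 := by
    rw [← hCd, analyticRank_smul]
    exact ((W.quadraticTwist (NumberField.discr K : ℚ)).analyticRank_eq_zero_iff_holds (hmod _)).mpr hL
  have hBd : BSDp Wd 2 := hS1 Wd hcmd hrd hSel1
  exact swappedPairDescentAtTwo_silent_of_facts hGZ hGZK hmod hMilneC W hr hSel K hK hodd h3 hH Dt hc0 β ι d₁ hy hdiv hndiv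
    Wd ⟨Cd, hCd⟩ hSel1 hSil hBd

end Summit.BirchSwinnertonDyer.BirchSwinnertonDyer.Theorems.GenusExact.TwinSwap.AllDepth

end
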